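import Summits.QuantumFields.BalabanUV.T4Continuum.Support.NE7CombLineSumCoercive
import Summits.QuantumFields.BalabanUV.T4Continuum.Support.NE7FluxGradientFromTension
import HarnessLib

/-!
# NE7SkewTorusForms — THE SKEW TORUS 1-FORMS AS A SUBMODULE OF `NE3HilbertSchmidtTorus.Form`, AND WHAT LIVES IN IT: the framed-back tension datum of
# a small-field configuration, the comb line sum `S′` of a skew form, and its adjoint `WadWg` of a skew coarse form (identification step (h7-e))

Cell `pub-balaban`, rung (B)+1 sub-cell t4, lineage `b2b-balaban-t4-ne7-p1`, generation 63 (CRUX PROVER NE7 #1, ruling e34b3e0c (2)); hunt (h7)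
«ENERGY ROAD».  WHY.  (E3‴) is applied on the skew forms (`NE7RestrictedOperator`, `NE7TensionKernelPerturbed`): this file supplies, def-free,
§1 **`exists_skewForms`** — `∃ K : Submodule ℝ (Form d n P), ∀ b, b ∈ K ↔ IsSkewDir (extF P b)` (closure under `+`, real scalars);
§2 `flux_mem_skewAdjoint` (`‖U(∂p) − 1‖ ≤ a ≤ 1∕4`, unitary `U`), `fluxForm_skew`, **`tensionDatum_skew`** (`Ad_{U(y,ν)}⁻¹ Σ_μ cDstar U μ B_{·μν}(y)` is
   skew) and **`resF_tensionDatum_mem`** (the `resF` datum of `NE7TensionKernelCoercivity` lies in `K`);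
§3 **`TWg_skew`** ∕ **`WadWg_skew`** (unitary transport family, skew input ⇒ skew output), hence **`combLineSum_mem`** (the CLM `S′` of
   `NE7CombLineSumCoercive.exists_combLineSum_clm` maps the skew fine forms into the skew coarse forms) and **`adjoint_combLineSum_mem`** (its
   adjoint maps skew coarse forms into skew fine forms) — the hypotheses `hS`, `hadj` of `NE7RestrictedOperator`.
HONEST FRAMING (page 1): bookkeeping at ONE unitary background; nothing about Bałaban's minimisers; NE7, NE3 NOT PRINTED in
[Balaban1984PropagatorsI]–[Balaban1989LargeFieldII] and NOT PROVED; FIXED FINITE torus, rung (B)+1; continuum YM on T⁴ ⇐ BetaPertH ∧ nine spine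
estimates (0/9 proved); BetaPertH ⇐ (D1) ∧ (D4) ∧ CAP+tail; G-an2-4 gates asym, D1 and NE2/3/4; NOT infinite volume, NOT mass gap, NOT Clay.
0 def, 0 sorry.
-/

set_option autoImplicit false

open scoped BigOperators InnerProductSpace Matrix Matrix.Norms.L2Operator
open Finset

namespace Summit.QuantumFields.BalabanUV.T4Continuum.NE7SkewTorusForms

open Literature.MathematicalPhysics.QuantumFieldTheory.Balaban1983to89
open B7Prop1Explicit B7Prop2Explicit MatrixLog MatrixNorms UnitaryModel
open T4AveragingDeficitWall (IsUnitaryCfg IsSkewDir SmallField Ad flux fhol)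
open T4AveragingDeficitWallBoundary (periodBox IsPeriodicCfg)
open AveragingDeficitTransport (Ad_mem_skewAdjoint)
open NE3CovariantCalculus (cDstar)
open NE3CovariantLineAdjoint
open NE3HilbertSchmidtTorus
open NE7CombLineSumCoercive (adjoint_combLineSum_apply)

noncomputable section

variable {d : ℕ} {n : Type*} [Fintype n] [DecidableEq n]

/-! ## §1 The skew torus 1-forms -/

omit [Fintype n] [DecidableEq n] in
/-- **THE SKEW TORUS 1-FORMS FORM A SUBMODULE**: `∃ K : Submodule ℝ (Form d n P), ∀ b, b ∈ K ↔ IsSkewDir (extF P b)` (existence; no def). [folklore] -/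
theorem exists_skewForms (P : ℕ) [NeZero P] :
    ∃ K : Submodule ℝ (Form d n P), ∀ b : Form d n P, b ∈ K ↔ IsSkewDir (extF P b) := by
  refine ⟨{ carrier := {b | IsSkewDir (extF P b)}
            add_mem' := fun {a b} ha hb x κ => ?_
            zero_mem' := fun x κ => ?_
            smul_mem' := fun t b hb x κ => ?_ }, fun b => Iff.rfl⟩
  · rw [extF_add]; exact (skewAdjoint (Matrix n n ℂ)).add_mem (ha x κ) (hb x κ)
  · show extF P (0 : Form d n P) x κ ∈ skewAdjoint (Matrix n n ℂ)
    have : extF P (0 : Form d n P) x κ = 0 := rfl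
    rw [this]; exact (skewAdjoint (Matrix n n ℂ)).zero_mem
  · show extF P (t • b) x κ ∈ skewAdjoint (Matrix n n ℂ)
    have : extF P (t • b) x κ = t • extF P b x κ := rfl
    rw [this]; exact skewAdjoint.smul_mem t (hb x κ)

/-! ## §2 The tension datum is skew -/

/-- The flux of a small-field unitary configuration is skew (`‖U(∂p) − 1‖ ≤ a ≤ 1∕4`: the logarithm of a unitary near `1`). [folklore] -/
theorem flux_mem_skewAdjoint [Nonempty n] {U : Site d → Fin d → (Matrix n n ℂ)ˣ} (hU : IsUnitaryCfg U) {a : ℝ} (ha : a ≤ 1 / 4)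
    (hUa : SmallField U a) (x : Site d) {μ ν : Fin d} (h : μ < ν) :
    flux U (x, ⟨(μ, ν), h⟩) ∈ skewAdjoint (Matrix n n ℂ) := by
  letI : CStarAlgebra (Matrix n n ℂ) := {}
  have hu : fhol U (x, ⟨(μ, ν), h⟩) ∈ unitaryUnits (Matrix n n ℂ) := hol_mem_of hU _ _
  have hsmall : ‖((fhol U (x, ⟨(μ, ν), h⟩) : (Matrix n n ℂ)ˣ) : Matrix n n ℂ) - 1‖ ≤ 1 / 4 := (hUa x μ ν (ne_of_lt h)).trans ha
  exact skewAdjoint.mem_iff.mpr (star_mlog_eq_neg (mem_unitaryUnits.mp hu) hsmall)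

/-- The antisymmetric flux form is skew-valued. [folklore] -/
theorem fluxForm_skew [Nonempty n] {U : Site d → Fin d → (Matrix n n ℂ)ˣ} (hU : IsUnitaryCfg U) {a : ℝ} (ha : a ≤ 1 / 4)
    (hUa : SmallField U a) {B : Site d → Fin d → Fin d → Matrix n n ℂ}
    (hBF : ∀ (x : Site d) (μ ν : Fin d) (h : μ < ν), B x μ ν = flux U (x, ⟨(μ, ν), h⟩))
    (hanti : ∀ (x : Site d) (μ ν : Fin d), B x ν μ = -B x μ ν) (x : Site d) (μ ν : Fin d) :
    B x μ ν ∈ skewAdjoint (Matrix n n ℂ) := by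
  rcases lt_trichotomy μ ν with h | h | h
  · rw [hBF x μ ν h]; exact flux_mem_skewAdjoint hU ha hUa x h
  · subst h; rw [NE7FluxGradientFromTension.fluxForm_diag hanti]; exact (skewAdjoint (Matrix n n ℂ)).zero_mem
  · rw [hanti x ν μ, hBF x ν μ h]; exact (skewAdjoint (Matrix n n ℂ)).neg_mem (flux_mem_skewAdjoint hU ha hUa x h)

/-- `cDstar U μ g y` is skew for unitary `U` and skew-valued `g`. [folklore] -/
theorem cDstar_skew {U : Site d → Fin d → (Matrix n n ℂ)ˣ} (hU : IsUnitaryCfg U) (μ : Fin d) {g : Site d → Matrix n n ℂ}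
    (hg : ∀ y, g y ∈ skewAdjoint (Matrix n n ℂ)) (y : Site d) : cDstar U μ g y ∈ skewAdjoint (Matrix n n ℂ) :=
  (skewAdjoint (Matrix n n ℂ)).sub_mem (Ad_mem_skewAdjoint ((unitaryUnits (Matrix n n ℂ)).inv_mem (hU _ μ)) (hg _)) (hg y)

/-- **THE FRAMED-BACK TENSION DATUM IS SKEW**: `Ad_{U(y,ν)}⁻¹ Σ_μ cDstar U μ B_{·μν}(y) ∈ 𝔲(N)` for skew-valued `B` at a unitary `U`. [folklore] -/
theorem tensionDatum_skew {U : Site d → Fin d → (Matrix n n ℂ)ˣ} (hU : IsUnitaryCfg U) {B : Site d → Fin d → Fin d → Matrix n n ℂ}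
    (hB : ∀ x μ ν, B x μ ν ∈ skewAdjoint (Matrix n n ℂ)) :
    IsSkewDir (fun y ν => Ad (U y ν)⁻¹ (∑ μ : Fin d, cDstar U μ (fun x => B x μ ν) y)) := fun y ν =>
  Ad_mem_skewAdjoint ((unitaryUnits (Matrix n n ℂ)).inv_mem (hU y ν))
    (sum_mem fun μ _ => cDstar_skew hU μ (fun x => hB x μ ν) y)

omit [Fintype n] [DecidableEq n] in
/-- The extension of a restricted field takes values of the field. [folklore] -/
theorem isSkewDir_extF_resF (P : ℕ) [NeZero P] {Y : Site d → Fin d → Matrix n n ℂ} (hY : IsSkewDir Y) :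
    IsSkewDir (extF P (resF (d := d) P Y)) := fun x κ => by
  simp only [extF, resF_apply, HSMat.ofHS_toHS]
  exact hY _ κ

/-- **THE `resF` TENSION DATUM LIES IN THE SKEW FORMS**: for `K` the skew submodule (`b ∈ K ↔ IsSkewDir (extF P b)`). [folklore] -/
theorem resF_tensionDatum_mem {P : ℕ} [NeZero P] {K : Submodule ℝ (Form d n P)} (hK : ∀ b : Form d n P, b ∈ K ↔ IsSkewDir (extF P b))
    {U : Site d → Fin d → (Matrix n n ℂ)ˣ} (hU : IsUnitaryCfg U) {B : Site d → Fin d → Fin d → Matrix n n ℂ}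
    (hB : ∀ x μ ν, B x μ ν ∈ skewAdjoint (Matrix n n ℂ)) :
    resF (d := d) P (fun y ν => Ad (U y ν)⁻¹ (∑ μ : Fin d, cDstar U μ (fun x => B x μ ν) y)) ∈ K :=
  (hK _).mpr (isSkewDir_extF_resF P (tensionDatum_skew hU hB))

/-! ## §3 The comb line sum and its adjoint preserve skewness -/

/-- **`TWg` OF A SKEW FIELD IS SKEW** for a unitary transport family. [folklore] -/
theorem TWg_skew (M : ℕ) {g : Site d → Fin d → Site d → ℕ → (Matrix n n ℂ)ˣ} (hg : ∀ z κ v i, g z κ v i ∈ unitaryUnits (Matrix n n ℂ))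
    {η : Site d → Fin d → Matrix n n ℂ} (hη : IsSkewDir η) : IsSkewDir (TWg M g η) := fun z κ => by
  unfold TWg
  exact sum_mem fun v _ => sum_mem fun i _ =>
    Ad_mem_skewAdjoint ((unitaryUnits (Matrix n n ℂ)).inv_mem (hg z κ v i)) (hη _ κ)

/-- **`WadWg` OF A SKEW COARSE FORM IS SKEW** for a unitary transport family. [folklore] -/
theorem WadWg_skew (M : ℕ) {g : Site d → Fin d → Site d → ℕ → (Matrix n n ℂ)ˣ} (hg : ∀ z κ v i, g z κ v i ∈ unitaryUnits (Matrix n n ℂ))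
    {ω : Site d → Fin d → Matrix n n ℂ} (hω : IsSkewDir ω) : IsSkewDir (WadWg M g ω) := fun x κ => by
  unfold WadWg
  exact sum_mem fun i _ => Ad_mem_skewAdjoint (hg _ κ _ i) (hω _ κ)

/-- **THE COMB LINE SUM MAPS SKEW FINE FORMS TO SKEW COARSE FORMS** (hypothesis `hS` of `NE7RestrictedOperator.exists_restrict`). [folklore] -/
theorem combLineSum_mem {M N : ℕ} [NeZero N] [NeZero (M * N)] {W : Site d → Fin d → (Matrix n n ℂ)ˣ} (hW : IsUnitaryCfg W)
    {Kf : Submodule ℝ (Form d n (M * N))} (hKf : ∀ b : Form d n (M * N), b ∈ Kf ↔ IsSkewDir (extF (M * N) b))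
    {Kc : Submodule ℝ (Form d n N)} (hKc : ∀ b : Form d n N, b ∈ Kc ↔ IsSkewDir (extF N b))
    (S : Form d n (M * N) →L[ℝ] Form d n N) (hS : ∀ η : Form d n (M * N), S η = resF N (TWg M (combFrame W M) (extF (M * N) η))) :
    ∀ b ∈ Kf, S b ∈ Kc := by
  intro b hb
  rw [hS b, hKc]
  exact isSkewDir_extF_resF N (TWg_skew M (fun z κ v i => combFrame_mem hW M z κ v i) ((hKf b).mp hb))

/-- **ITS ADJOINT MAPS SKEW COARSE FORMS TO SKEW FINE FORMS** (hypothesis `hadj` of `NE7RestrictedOperator.adjoint_restrict_apply`). [folklore] -/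
theorem adjoint_combLineSum_mem {M N : ℕ} [NeZero N] [NeZero (M * N)] (hM : 1 ≤ M) (hN : 1 ≤ N)
    {W : Site d → Fin d → (Matrix n n ℂ)ˣ} (hW : IsUnitaryCfg W) (hWP : IsPeriodicCfg W ((M * N : ℕ) : ℤ))
    {Kf : Submodule ℝ (Form d n (M * N))} (hKf : ∀ b : Form d n (M * N), b ∈ Kf ↔ IsSkewDir (extF (M * N) b))
    {Kc : Submodule ℝ (Form d n N)} (hKc : ∀ b : Form d n N, b ∈ Kc ↔ IsSkewDir (extF N b))
    (S : Form d n (M * N) →L[ℝ] Form d n N) (hS : ∀ η : Form d n (M * N), S η = resF N (TWg M (combFrame W M) (extF (M * N) η))) :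
    ∀ ω ∈ Kc, ContinuousLinearMap.adjoint S ω ∈ Kf := by
  intro ω hω
  rw [adjoint_combLineSum_apply hM hN hW hWP S hS ω, hKf]
  exact isSkewDir_extF_resF (M * N) (WadWg_skew M (fun z κ v i => combFrame_mem hW M z κ v i) ((hKc ω).mp hω))

end

end Summit.QuantumFields.BalabanUV.T4Continuum.NE7SkewTorusForms
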